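import Mathlib
import Literature.NumberTheory.LFunctions.Zhang2022.AppendixBVarrhoB1Core
import HarnessLib

/-!
# Zhang (2022), Appendix B, (B.1): `Σ_{n<P, (n,𝔮)=1} |ϱ_j(n) − ϱ*_j(n)|/n ≪ 𝓛⁻⁸` under (A)

Topic `Literature/NumberTheory/LFunctions/Zhang2022` (Landau–Siegel audit tree; verdict-neutral).
Y. Zhang, *Discrete mean estimates and the Landau–Siegel zero*, arXiv:2211.02515v1 (2022)
[Zhang2022LandauSiegel] — **an unrefereed manuscript under adjudication**. This file PROVES display
**(B.1)** of Appendix B (proof of Lemma 15.1, p. 106 of the source, tex L5253): under Assumption (A)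
and for `D` large, for every `j` (`β_j ∈ {β₁,β₂,β₃}`, (2.13)) and every range `n ≤ X ≤ ⌊P²⌋`,
`Σ_{n≤X, (n,𝔮)=1} |ϱ_j(n) − ϱ*_j(n)|/n ≤ C𝓛⁻⁸` (`appB1_bound`; `ϱ_j(n) = Σ_{d∣n} μ(d)d^{β_j}`,
`ϱ*_j = Skeleton.varrhoStar` (15.21), `𝔮 = Skeleton.frakq`, `𝓛 = Skeleton.ell`, `P = Skeleton.bigP`).
Ingredients: the divisor-sum swap of the companion file (`AppendixBVarrho.sum_coprime_norm_sub_le`: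
`≤ (Σ_{k≤X} 1/k)²·Σ_{D⁴<h≤X} |ν(h)|/h`, the source's "`≪ (log P)² Σ_{D⁴<h<P} ν(h)/h`"), then
Cauchy–Schwarz and **Lemma 3.1** (a THEOREM of the tree, `Lemma31.lemma_3_1`:
`Σ_{D⁴<n≤P²} |ν(n)|²/n ≤ C𝓛⁻²⁰¹¹` under (A)): `Σ_{D⁴<h≤X}|ν(h)|/h ≤ (C𝓛⁻²⁰¹¹)^{1/2}(3𝓛⁹)^{1/2}`, so
the display holds with room to spare (`27|C|^{1/2}𝓛⁻⁹⁷⁸ ≤ 27|C|^{1/2}𝓛⁻⁸`).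
RECORDED, NOT REPAIRED SILENTLY: the source ends the proof of (B.1) with "This together with Lemma 3.2
yields (B.1)"; Lemma 3.2 (`Σ_{D⁴<n≤D⁸} ν(n)²τ₂(n)²/n ≪ 𝓛⁻²⁰⁰⁷`, range `D⁸ ≪ P`, other summand) does not
give the printed display, Lemma 3.1 + Cauchy–Schwarz does; the kernel edge here is `Lemma 3.1 ⇒ (B.1)`.
DAG node (cell siegel-zhang): `Z22:(B.1)`. What is NOT here: (B.2) (`AppendixBVarrhoB2`), the rest of
the proof of Lemma 15.1, any claim about Theorems 1–2 of the source or about Landau–Siegel zeros.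
-/

noncomputable section

open Complex Real Finset ArithmeticFunction

namespace Literature.NumberTheory.LFunctions.Zhang2022.AppendixBVarrho

open Literature.NumberTheory.LFunctions.Zhang2022 Skeleton

/-- **Cauchy–Schwarz for the last step**: `Σ_{Y<h≤X} |ν(h)|/h ≤ (Σ_{Y<h≤X} |ν(h)|²/h)^{1/2}(Σ_{k≤X} 1/k)^{1/2}`.
[folklore] -/
private theorem sum_norm_div_le_sqrt {D : ℕ} (χ : DirichletCharacter ℂ D) (Y X : ℕ) :
    ∑ h ∈ Ioc Y X, ‖divisorSumChar χ h‖ / h ≤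
      Real.sqrt (∑ h ∈ Ioc Y X, ‖divisorSumChar χ h‖ ^ 2 / h) *
        Real.sqrt (∑ k ∈ Icc 1 X, (1 : ℝ) / k) := by
  have hcs := Finset.sum_mul_sq_le_sq_mul_sq (Ioc Y X)
    (fun h => ‖divisorSumChar χ h‖ / Real.sqrt h) (fun h => 1 / Real.sqrt h)
  have hfg : ∀ h ∈ Ioc Y X, ‖divisorSumChar χ h‖ / Real.sqrt h * (1 / Real.sqrt h) =
      ‖divisorSumChar χ h‖ / h := by
    intro h hh
    have h0 : (0 : ℝ) ≤ h := Nat.cast_nonneg h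
    rw [div_mul_div_comm, mul_one, Real.mul_self_sqrt h0]
  have hf2 : ∀ h ∈ Ioc Y X, (‖divisorSumChar χ h‖ / Real.sqrt h) ^ 2 = ‖divisorSumChar χ h‖ ^ 2 / h := by
    intro h hh
    rw [div_pow, Real.sq_sqrt (Nat.cast_nonneg h)]
  have hg2 : ∀ h ∈ Ioc Y X, (1 / Real.sqrt (h : ℝ)) ^ 2 = 1 / h := by
    intro h hh
    rw [div_pow, one_pow, Real.sq_sqrt (Nat.cast_nonneg h)]
  rw [sum_congr rfl hfg, sum_congr rfl hf2, sum_congr rfl hg2] at hcs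
  have hsub : ∑ h ∈ Ioc Y X, (1 : ℝ) / h ≤ ∑ k ∈ Icc 1 X, (1 : ℝ) / k := by
    refine sum_le_sum_of_subset_of_nonneg ?_ fun k _ _ => by positivity
    intro h hh; simp only [mem_Ioc, mem_Icc] at hh ⊢; omega
  have hA : 0 ≤ ∑ h ∈ Ioc Y X, ‖divisorSumChar χ h‖ ^ 2 / h := sum_nonneg fun h _ => by positivity
  calc ∑ h ∈ Ioc Y X, ‖divisorSumChar χ h‖ / h
      ≤ |∑ h ∈ Ioc Y X, ‖divisorSumChar χ h‖ / h| := le_abs_self _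
    _ ≤ Real.sqrt ((∑ h ∈ Ioc Y X, ‖divisorSumChar χ h‖ ^ 2 / h) * ∑ h ∈ Ioc Y X, (1 : ℝ) / h) :=
        Real.abs_le_sqrt hcs
    _ ≤ Real.sqrt ((∑ h ∈ Ioc Y X, ‖divisorSumChar χ h‖ ^ 2 / h) * ∑ k ∈ Icc 1 X, (1 : ℝ) / k) := by
        gcongr
    _ = _ := Real.sqrt_mul hA _

/-! ## (B.1) in the source's setting -/

/-- Every prime `p ≤ D⁴` divides `𝔮 = ∏_{q<D⁴} q` (`D ≥ 2`; `D⁴` itself is not prime).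
[cite: Zhang2022LandauSiegel, §15 p. 31 (definition of 𝔮)] -/
theorem prime_dvd_frakq {D : ℕ} (hD : 2 ≤ D) {p : ℕ} (hp : p.Prime) (hpD : p ≤ D ^ 4) : p ∣ frakq D := by
  have hlt : p < D ^ 4 := by
    rcases hpD.lt_or_eq with h | h
    · exact h
    · exfalso
      rw [h] at hp
      rcases hp.eq_one_or_self_of_dvd D (dvd_pow_self D (by norm_num)) with h1 | h1
      · omega
      · have : D * D ≤ D ^ 4 := by
          calc D * D = D ^ 2 := (sq D).symm
            _ ≤ D ^ 4 := Nat.pow_le_pow_right (by omega) (by norm_num)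
        nlinarith
  exact Finset.dvd_prod_of_mem _ (mem_filter.mpr ⟨Finset.mem_range.mpr hlt, hp⟩)

/-- `β_j` is purely imaginary: `Re β_j = 0` ((2.13)); private copy of the tree's `Skeleton.betaJ_re`
(`Section10TentMellin`), kept local to avoid the import. [cite: Zhang2022LandauSiegel, §2 (2.13)] -/
private theorem betaJ_re' (c' : ℝ) (D j : ℕ) : (betaJ c' D j).re = 0 := by
  unfold betaJ beta1 beta2 beta3
  split_ifs <;> simp

/-- **(B.1)** (Appendix B, p. 106 of the source): under (A) and for `D` large,
"`Σ_{n<P, (n,𝔮)=1} |ϱ_j(n) − ϱ*_j(n)|/n ≪ 𝓛⁻⁸`", PROVED for every `j` and every range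
`n ≤ X ≤ ⌊P²⌋` (any reading of "`n < P`" is a sub-range), with `ϱ_j(n) = Σ_{d∣n} μ(d)d^{β_j}` spelled
out and `ϱ*_j = Skeleton.varrhoStar`. The last step uses Lemma 3.1 (tree theorem
`Lemma31.lemma_3_1`) + Cauchy–Schwarz — see the module docstring on the source's "Lemma 3.2".
Constant: `27·|C₃.₁|^{1/2}`, in fact `≪ 𝓛⁻⁹⁷⁸`. DAG node `Z22:(B.1)`.
[cite: Zhang2022LandauSiegel, Appendix B (B.1)] -/
theorem appB1_bound (c' : ℝ) : ∃ C : ℝ, ForAllLarge fun D _ χ => AssumptionA D χ →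
    ∀ j X : ℕ, X ≤ ⌊bigP D ^ 2⌋₊ →
      ∑ n ∈ (Icc 1 X).filter (fun n => Nat.Coprime n (frakq D)),
        ‖(∑ d ∈ n.divisors, (ArithmeticFunction.moebius d : ℂ) * (d : ℂ) ^ betaJ c' D j) -
            varrhoStar c' χ j n‖ / n ≤ C / ell D ^ 8 := by
  obtain ⟨C, hC⟩ := Lemma31.lemma_3_1
  refine ⟨27 * Real.sqrt |C|, ⌈Real.exp 3⌉₊, fun D _ χ hD hq hp hA j X hX => ?_⟩
  -- the parameters
  have hD3 : Real.exp 3 ≤ D := le_trans (Nat.le_ceil _) (by exact_mod_cast hD)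
  have hD0 : (0 : ℝ) < D := lt_of_lt_of_le (Real.exp_pos 3) hD3
  have hlog : 3 ≤ Real.log D := (Real.le_log_iff_exp_le hD0).mpr hD3
  have hD2 : 2 ≤ D := by
    have h4 : (4 : ℝ) ≤ Real.exp 3 := by linarith [Real.add_one_le_exp (3 : ℝ)]
    exact_mod_cast (show (2 : ℝ) ≤ D by linarith)
  have hℓ : 1 ≤ ell D := by unfold ell; linarith
  have hℓ0 : 0 < ell D := by linarith
  -- Lemma 3.1 at `N = X ≤ P²`
  have hXP : (X : ℝ) ≤ Real.exp (2 * Real.log D ^ 9) := by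
    calc (X : ℝ) ≤ ⌊bigP D ^ 2⌋₊ := by exact_mod_cast hX
      _ ≤ bigP D ^ 2 := Nat.floor_le (by positivity)
      _ = Real.exp (2 * Real.log D ^ 9) := by unfold bigP ell; rw [← Real.exp_nat_mul]; norm_num
  have h31 : ∑ n ∈ Ioc (D ^ 4) X, ‖divisorSumChar χ n‖ ^ 2 / n ≤ C / ell D ^ 2011 :=
    hC D χ hp hq.sq_eq_one hlog hA.le X hXP
  -- the divisor-sum swap and Cauchy–Schwarz
  have hQ : ∀ p, p.Prime → p ≤ D ^ 4 → p ∣ frakq D := fun p hp' hp4 => prime_dvd_frakq hD2 hp' hp4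
  have hmain := sum_coprime_norm_sub_le χ (betaJ_re' c' D j) hQ X
  have hcs := sum_norm_div_le_sqrt χ (D ^ 4) X
  set H : ℝ := ∑ k ∈ Icc 1 X, (1 : ℝ) / k with hH
  set L : ℝ := ∑ h ∈ Ioc (D ^ 4) X, ‖divisorSumChar χ h‖ ^ 2 / h with hL
  have hH0 : 0 ≤ H := sum_nonneg fun k _ => by positivity
  -- `H ≤ 3𝓛⁹`
  have hHb : H ≤ 3 * ell D ^ 9 := by
    have h1 : H ≤ 1 + Real.log X := Literature.NumberTheory.Sieve.sum_Icc_one_div_le_one_add_log X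
    have h2 : Real.log X ≤ 2 * ell D ^ 9 := by
      rcases Nat.eq_zero_or_pos X with rfl | hX0
      · simp only [Nat.cast_zero, Real.log_zero]; positivity
      · calc Real.log X ≤ Real.log (Real.exp (2 * Real.log D ^ 9)) :=
            Real.log_le_log (by exact_mod_cast hX0) hXP
          _ = 2 * ell D ^ 9 := by rw [Real.log_exp]; rfl
    have h3 : (1 : ℝ) ≤ ell D ^ 9 := one_le_pow₀ hℓ
    linarith
  have hHb1 : 1 ≤ 3 * ell D ^ 9 := by nlinarith [one_le_pow₀ (n := 9) hℓ]
  -- `√L ≤ √|C| / 𝓛¹⁰⁰⁵`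
  have hsqrtL : Real.sqrt L ≤ Real.sqrt |C| / ell D ^ 1005 := by
    have hL' : L ≤ (Real.sqrt |C| / ell D ^ 1005) ^ 2 := by
      rw [div_pow, Real.sq_sqrt (abs_nonneg C)]
      calc L ≤ C / ell D ^ 2011 := h31
        _ ≤ |C| / ell D ^ 2011 := by gcongr; exact le_abs_self C
        _ ≤ |C| / (ell D ^ 1005) ^ 2 := by
            rw [← pow_mul]
            exact div_le_div_of_nonneg_left (abs_nonneg C) (by positivity)
              (pow_le_pow_right₀ hℓ (by norm_num))
    calc Real.sqrt L ≤ Real.sqrt ((Real.sqrt |C| / ell D ^ 1005) ^ 2) := Real.sqrt_le_sqrt hL'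
      _ = Real.sqrt |C| / ell D ^ 1005 := Real.sqrt_sq (by positivity)
  -- `√H ≤ 3𝓛⁹`
  have hsqrtH : Real.sqrt H ≤ 3 * ell D ^ 9 := by
    rw [Real.sqrt_le_left (by positivity)]
    nlinarith
  -- assemble
  have hstar : ∀ n : ℕ, varrhoStar c' χ j n =
      ∑ d ∈ n.divisors, ((d : ℕ) : ℂ) ^ betaJ c' D j * χ ((d : ℕ) : ZMod D) := fun n => rfl
  simp only [hstar]
  calc _ ≤ H ^ 2 * ∑ h ∈ Ioc (D ^ 4) X, ‖divisorSumChar χ h‖ / h := hmain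
    _ ≤ H ^ 2 * (Real.sqrt L * Real.sqrt H) := by gcongr
    _ ≤ (3 * ell D ^ 9) ^ 2 * (Real.sqrt |C| / ell D ^ 1005 * (3 * ell D ^ 9)) := by
        gcongr
    _ = 27 * Real.sqrt |C| * (ell D ^ 27 / ell D ^ 1005) := by ring
    _ ≤ 27 * Real.sqrt |C| * (1 / ell D ^ 8) := by
        refine mul_le_mul_of_nonneg_left ?_ (by positivity)
        rw [div_le_div_iff₀ (by positivity) (by positivity), one_mul, ← pow_add]
        exact pow_le_pow_right₀ hℓ (by norm_num)
    _ = 27 * Real.sqrt |C| / ell D ^ 8 := by ring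

end Literature.NumberTheory.LFunctions.Zhang2022.AppendixBVarrho
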